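import Summits.QuantumFields.YangMills.Theorems.IR.TensionRatioPlaquetteFloorProjection
import Mathlib.Topology.ContinuousMap.StoneWeierstrass
import Literature.MathematicalPhysics.QuantumFieldTheory.ContinuumLimitsYM2Ergodic
import HarnessLib

/-!
# Crux `IR` (stmt-QuantumFields-19354), line `tension-ratio`, input `PlaquetteFloorSC` — part 2:
# the order of the `π`-plaquette and the positivity of its leading Haar coefficient

Pooled prover `ym-ir-line-pool-p3` (gen 3).  Helper module for item `stmt-QuantumFields-19354` (`--supports`; it closes
nothing).  For a compact group `G`, a FAITHFUL continuous unitary matrix representation `ρ` (the action's) and ANY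
continuous matrix representation `π` of positive size (the probe), consider the single-link Haar integrals
`I(K; M₁,…,Mₙ) = ∫ Re tr(π(g)K) ∏ᵢ Re tr(ρ(g)Mᵢ) dg`.

* §1 If all of them vanish for every `n < k`, then so do all their AFFINE and ORIENTED variants
  `∫ Re tr(π(g^{±1})K) ∏ᵢ (aᵢ + Re tr(ρ(g^{±1})Mᵢ)) dg` with fewer than `k` factors, over any finite index type
  (expand the affine product; unitarity `ρ(g⁻¹) = ρ(g)ᴴ`; inversion invariance of Haar measure for `π(g⁻¹)`).  This is the
  form consumed on the torus (part 3): integrating ONE bond of the plaquette kills every strong-coupling monomial that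
  covers that bond fewer than `k` times.
* §2 Some `I(K; M)` is non-zero (`exists_integral_ne_zero`): otherwise `∫ Re tr(π(g)K)·f(g) dg = 0` for every `f` in the
  real subalgebra of `C(G, ℝ)` generated by the functions `g ↦ Re tr(ρ(g)M)`, which separates points because `ρ` is
  faithful, hence (real Stone–Weierstrass, Mathlib) for every continuous `f`; `f = Re tr π`, `K = 1` gives `Re tr π ≡ 0`,
  absurd at `g = 1`.  (This replaces the Peter–Weyl/Burnside statement «every irreducible constituent of `π` occurs in some
  `ρ^{⊗a} ⊗ ρ̄^{⊗b}`», Bröcker–tom Dieck III.4.)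
* §3 `exists_order`: there is an ORDER `k` — all integrals with `n < k` factors vanish — at which the floor coefficient
  is positive, `∫ Re tr π(g) (Re tr ρ(g))^k dg ≥ 2^{-k}` (part 1: a non-vanishing integral at order `k` forces a non-zero
  idempotent `P_t`, whose trace is a positive integer).  For centre-charged `π` one has `k ≥ 1`; for the fundamental loop of
  `SU(N)` `k = 1` — neither fact is needed.

Everything is proved; no new definitions; nothing here bears on the Yang–Mills mass gap.
-/

set_option autoImplicit false

noncomputable section

open MeasureTheory Finset
open Literature.MathematicalPhysics.QuantumFieldTheory (haarProbability)
open Literature.MathematicalPhysics.QuantumFieldTheory (YM2.integrable_of_continuous)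

namespace Summit.QuantumFields.YangMills.Cruxes.IR.TensionRatio.PlaquetteFloor

variable {G : Type*} [Group G] [TopologicalSpace G] [IsTopologicalGroup G] [CompactSpace G]
  [MeasurableSpace G] [BorelSpace G] {m N : ℕ}

/-! ## §0 Continuity and integrability of the single-link integrands -/

omit [IsTopologicalGroup G] [CompactSpace G] [MeasurableSpace G] [BorelSpace G] in
/-- `g ↦ Re tr(π(g) K)` is continuous. -/
theorem continuous_re_trace_mul {n : ℕ} (π : G →* Matrix (Fin n) (Fin n) ℂ) (hπ : Continuous π)
    (K : Matrix (Fin n) (Fin n) ℂ) : Continuous fun g => (π g * K).trace.re :=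
  Complex.continuous_re.comp ((hπ.mul continuous_const).matrix_trace)

omit [TopologicalSpace G] [IsTopologicalGroup G] [CompactSpace G] [MeasurableSpace G] [BorelSpace G] in
/-- **Unitarity turns the reversed orientation into the standard one**: `Re tr(ρ(g⁻¹) M) = Re tr(ρ(g) Mᴴ)`. -/
theorem re_trace_map_inv_mul (ρ : G →* Matrix (Fin N) (Fin N) ℂ)
    (hρu : ∀ g, ρ g ∈ Matrix.unitaryGroup (Fin N) ℂ) (g : G) (M : Matrix (Fin N) (Fin N) ℂ) :
    (ρ g⁻¹ * M).trace.re = (ρ g * M.conjTranspose).trace.re := by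
  have hinv : ρ g⁻¹ = star (ρ g) := by
    have h1 : ρ g * star (ρ g) = 1 := Matrix.mem_unitaryGroup_iff.1 (hρu g)
    calc ρ g⁻¹ = ρ g⁻¹ * (ρ g * star (ρ g)) := by rw [h1, mul_one]
      _ = star (ρ g) := by rw [← mul_assoc, ← map_mul, inv_mul_cancel, map_one, one_mul]
  have hstar : star (ρ g) * M = star (M.conjTranspose * ρ g) := by
    rw [Matrix.star_eq_conjTranspose, Matrix.star_eq_conjTranspose, Matrix.conjTranspose_mul,
      Matrix.conjTranspose_conjTranspose]
  rw [hinv, hstar, Matrix.star_eq_conjTranspose, Matrix.trace_conjTranspose, Matrix.trace_mul_comm,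
    Complex.star_def, Complex.conj_re]

/-! ## §1 Consequences of vanishing below the order -/

section BelowOrder

variable (π : G →* Matrix (Fin m) (Fin m) ℂ) (ρ : G →* Matrix (Fin N) (Fin N) ℂ) {k : ℕ}

/-- Transport to an arbitrary finite index type. -/
theorem integral_prod_eq_zero_of_card_lt {ι : Type*} [Fintype ι]
    (hV : ∀ n < k, ∀ (K : Matrix (Fin m) (Fin m) ℂ) (M : Fin n → Matrix (Fin N) (Fin N) ℂ),
      ∫ g, (π g * K).trace.re * ∏ i, (ρ g * M i).trace.re ∂haarProbability G = 0)
    (hι : Fintype.card ι < k) (K : Matrix (Fin m) (Fin m) ℂ) (M : ι → Matrix (Fin N) (Fin N) ℂ) :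
    ∫ g, (π g * K).trace.re * ∏ i, (ρ g * M i).trace.re ∂haarProbability G = 0 := by
  set e := Fintype.equivFin ι
  have hprod : ∀ g, ∏ i, (ρ g * M i).trace.re = ∏ j, (ρ g * M (e.symm j)).trace.re := fun g =>
    Fintype.prod_equiv e _ _ fun i => by rw [Equiv.symm_apply_apply]
  simp_rw [hprod]
  exact hV _ hι K fun j => M (e.symm j)

/-- **Affine factors**: with fewer than `k` factors `aᵢ + Re tr(ρ(g)Mᵢ)` the integral still vanishes. -/
theorem integral_affine_prod_eq_zero {ι : Type*} [Fintype ι] [DecidableEq ι] (hπ : Continuous π)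
    (hρ : Continuous ρ)
    (hV : ∀ n < k, ∀ (K : Matrix (Fin m) (Fin m) ℂ) (M : Fin n → Matrix (Fin N) (Fin N) ℂ),
      ∫ g, (π g * K).trace.re * ∏ i, (ρ g * M i).trace.re ∂haarProbability G = 0)
    (hι : Fintype.card ι < k) (K : Matrix (Fin m) (Fin m) ℂ) (a : ι → ℝ) (M : ι → Matrix (Fin N) (Fin N) ℂ) :
    ∫ g, (π g * K).trace.re * ∏ i, (a i + (ρ g * M i).trace.re) ∂haarProbability G = 0 := by
  have hexp : ∀ g, (π g * K).trace.re * ∏ i, (a i + (ρ g * M i).trace.re) =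
      ∑ t : Finset ι, (∏ i ∈ t, a i) * ((π g * K).trace.re * ∏ i : ↥(tᶜ), (ρ g * M i).trace.re) := by
    intro g
    rw [Fintype.prod_add, Finset.mul_sum]
    refine Finset.sum_congr rfl fun t _ => ?_
    rw [← Finset.prod_coe_sort (tᶜ)]
    ring
  simp_rw [hexp]
  have hint : ∀ t : Finset ι, Integrable
      (fun g => (∏ i ∈ t, a i) * ((π g * K).trace.re * ∏ i : ↥(tᶜ), (ρ g * M i).trace.re))
      (haarProbability G) := fun t =>
    YM2.integrable_of_continuous (continuous_const.mul ((continuous_re_trace_mul π hπ K).mul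
      (continuous_finsetProd _ fun i _ => continuous_re_trace_mul ρ hρ (M i))))
  rw [integral_finsetSum _ fun t _ => hint t]
  refine Finset.sum_eq_zero fun t _ => ?_
  rw [integral_const_mul, integral_prod_eq_zero_of_card_lt π ρ hV ?_ K (fun i : ↥(tᶜ) => M i), mul_zero]
  calc Fintype.card ↥(tᶜ) = (tᶜ).card := Fintype.card_coe _
    _ ≤ Fintype.card ι := Finset.card_le_univ _
    _ < k := hι

/-- **Oriented affine factors** (`ρ` unitary): every factor may read `g` or `g⁻¹`, the `π`-factor reads `g`. -/
theorem integral_affine_prod_eq_zero_oriented {ι : Type*} [Fintype ι] [DecidableEq ι] (hπ : Continuous π)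
    (hρ : Continuous ρ) (hρu : ∀ g, ρ g ∈ Matrix.unitaryGroup (Fin N) ℂ)
    (hV : ∀ n < k, ∀ (K : Matrix (Fin m) (Fin m) ℂ) (M : Fin n → Matrix (Fin N) (Fin N) ℂ),
      ∫ g, (π g * K).trace.re * ∏ i, (ρ g * M i).trace.re ∂haarProbability G = 0)
    (hι : Fintype.card ι < k) (K : Matrix (Fin m) (Fin m) ℂ) (o : ι → Bool) (a : ι → ℝ)
    (M : ι → Matrix (Fin N) (Fin N) ℂ) :
    ∫ g, (π g * K).trace.re * ∏ i, (a i + (ρ (if o i then g else g⁻¹) * M i).trace.re) ∂haarProbability G = 0 ∧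
    ∫ g, (π g * K).trace.re * ∏ i, (a i + (ρ (if o i then g⁻¹ else g) * M i).trace.re) ∂haarProbability G = 0 := by
  have h1 : ∀ (g : G) (i : ι), (ρ (if o i then g else g⁻¹) * M i).trace.re =
      (ρ g * (if o i then M i else (M i).conjTranspose)).trace.re := fun g i => by
    cases o i
    · simp only [Bool.false_eq_true, ↓reduceIte]; exact re_trace_map_inv_mul ρ hρu g (M i)
    · simp only [↓reduceIte]
  have h2 : ∀ (g : G) (i : ι), (ρ (if o i then g⁻¹ else g) * M i).trace.re =
      (ρ g * (if o i then (M i).conjTranspose else M i)).trace.re := fun g i => by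
    cases o i
    · simp only [Bool.false_eq_true, ↓reduceIte]
    · simp only [↓reduceIte]; exact re_trace_map_inv_mul ρ hρu g (M i)
  constructor
  · simp_rw [h1]; exact integral_affine_prod_eq_zero π ρ hπ hρ hV hι K a _
  · simp_rw [h2]; exact integral_affine_prod_eq_zero π ρ hπ hρ hV hι K a _

/-- **The single-link vanishing lemma in the form used on the torus.**  `F(g) = c · Re tr(π(g^{±1})K)` (the observable read
through one bond) times fewer than `k` factors `φᵢ(g) = aᵢ + Re tr(ρ(g^{±1})Mᵢ)` (the plaquette costs through that bond)
integrates to zero. -/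
theorem integral_linkObs_mul_prod_eq_zero {ι : Type*} [Fintype ι] [DecidableEq ι] (hπ : Continuous π)
    (hρ : Continuous ρ) (hρu : ∀ g, ρ g ∈ Matrix.unitaryGroup (Fin N) ℂ)
    (hV : ∀ n < k, ∀ (K : Matrix (Fin m) (Fin m) ℂ) (M : Fin n → Matrix (Fin N) (Fin N) ℂ),
      ∫ g, (π g * K).trace.re * ∏ i, (ρ g * M i).trace.re ∂haarProbability G = 0)
    (hι : Fintype.card ι < k) {F : G → ℝ}
    (hF : ∃ (c : ℝ) (K : Matrix (Fin m) (Fin m) ℂ) (o₀ : Bool), ∀ g, F g = c * (π (if o₀ then g else g⁻¹) * K).trace.re)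
    {φ : ι → G → ℝ}
    (hφ : ∀ i, ∃ (a : ℝ) (M : Matrix (Fin N) (Fin N) ℂ) (o : Bool),
      ∀ g, φ i g = a + (ρ (if o then g else g⁻¹) * M).trace.re) :
    ∫ g, F g * ∏ i, φ i g ∂haarProbability G = 0 := by
  obtain ⟨c, K, o₀, hF⟩ := hF
  choose a M o hφ using hφ
  simp_rw [hF, hφ]
  cases o₀
  · -- the observable reads `g⁻¹`: substitute `g ↦ g⁻¹`
    simp only [Bool.false_eq_true, ↓reduceIte]
    have hsub := integral_inv_eq_self
      (fun g => c * (π g * K).trace.re * ∏ i, (a i + (ρ (if o i then g⁻¹ else g) * M i).trace.re))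
      (haarProbability G)
    have hrw : ∀ g : G, (c * (π g⁻¹ * K).trace.re * ∏ i, (a i + (ρ (if o i then g else g⁻¹) * M i).trace.re)) =
        (c * (π g⁻¹ * K).trace.re * ∏ i, (a i + (ρ (if o i then g⁻¹⁻¹ else g⁻¹) * M i).trace.re)) := fun g => by
      simp only [inv_inv]
    simp_rw [hrw, hsub, mul_assoc, integral_const_mul]
    rw [(integral_affine_prod_eq_zero_oriented π ρ hπ hρ hρu hV hι K o a M).2, mul_zero]
  · simp only [↓reduceIte]
    simp_rw [mul_assoc, integral_const_mul]
    rw [(integral_affine_prod_eq_zero_oriented π ρ hπ hρ hρu hV hι K o a M).1, mul_zero]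

end BelowOrder

/-! ## §2 Existence of a non-vanishing single-link integral (faithful `ρ`; real Stone–Weierstrass) -/

section Existence

variable (π : G →* Matrix (Fin m) (Fin m) ℂ) (ρ : G →* Matrix (Fin N) (Fin N) ℂ)

omit [TopologicalSpace G] [IsTopologicalGroup G] [CompactSpace G] [MeasurableSpace G] [BorelSpace G] in
/-- `Re tr(A · single d c z) = Re (A_{cd} z)`: the generators contain real and imaginary parts of every entry. -/
theorem re_trace_mul_single (A : Matrix (Fin N) (Fin N) ℂ) (c d : Fin N) (z : ℂ) :
    (A * Matrix.single d c z).trace.re = (A c d * z).re := by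
  rw [Matrix.trace_mul_comm, Matrix.trace_single_mul, smul_eq_mul, mul_comm]

/-- Step 1: if all single-link integrals vanish, the functional `f ↦ ∫ Re tr(π g K) f(g)` kills the real subalgebra of
`C(G, ℝ)` generated by the functions `gen M : g ↦ Re tr(ρ(g) M)`. -/
theorem integral_mul_eq_zero_of_mem_adjoin (hπ : Continuous π)
    (gen : Matrix (Fin N) (Fin N) ℂ → C(G, ℝ)) (hgen : ∀ M g, gen M g = (ρ g * M).trace.re)
    (h0 : ∀ (n : ℕ) (K : Matrix (Fin m) (Fin m) ℂ) (M : Fin n → Matrix (Fin N) (Fin N) ℂ),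
      ∫ g, (π g * K).trace.re * ∏ i, (ρ g * M i).trace.re ∂haarProbability G = 0)
    {f : C(G, ℝ)} (hf : f ∈ Algebra.adjoin ℝ (Set.range gen)) (K : Matrix (Fin m) (Fin m) ℂ) :
    ∫ g, (π g * K).trace.re * f g ∂haarProbability G = 0 := by
  -- on the monoid generated by the generators, with spectator factors
  have hmon : ∀ f ∈ Submonoid.closure (Set.range gen), ∀ (n : ℕ) (M : Fin n → Matrix (Fin N) (Fin N) ℂ),
      ∫ g, (π g * K).trace.re * (f g * ∏ i, (ρ g * M i).trace.re) ∂haarProbability G = 0 := by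
    intro f hf
    induction hf using Submonoid.closure_induction_left with
    | one =>
        intro n M
        simpa only [ContinuousMap.one_apply, one_mul] using h0 n K M
    | mul_left x hx y _ ih =>
        obtain ⟨M₀, rfl⟩ := hx
        intro n M
        have h := ih (n + 1) (Fin.cons M₀ M : Fin (n + 1) → Matrix (Fin N) (Fin N) ℂ)
        have hrw : ∀ g : G, (gen M₀ * y) g * ∏ i, (ρ g * M i).trace.re =
            y g * ∏ i : Fin (n + 1), (ρ g * (Fin.cons M₀ M : Fin (n + 1) → Matrix (Fin N) (Fin N) ℂ) i).trace.re :=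
          fun g => by
          rw [Fin.prod_univ_succ, Fin.cons_zero]
          simp only [Fin.cons_succ, ContinuousMap.mul_apply, hgen]
          ring
        simp_rw [hrw]
        exact h
  -- on its real span = the subalgebra
  have hf' : f ∈ Subalgebra.toSubmodule (Algebra.adjoin ℝ (Set.range gen)) := hf
  rw [Algebra.adjoin_eq_span] at hf'
  refine Submodule.span_induction (p := fun f _ => ∫ g, (π g * K).trace.re * f g ∂haarProbability G = 0)
    ?_ ?_ ?_ ?_ hf'
  · intro f hf
    simpa only [Finset.univ_eq_empty, Finset.prod_empty, mul_one] using hmon f hf 0 Fin.elim0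
  · simp only [ContinuousMap.zero_apply, mul_zero, integral_zero]
  · intro f f' _ _ hf hf'
    have hi : Integrable (fun g => (π g * K).trace.re * f g) (haarProbability G) :=
      YM2.integrable_of_continuous ((continuous_re_trace_mul π hπ K).mul f.continuous)
    have hi' : Integrable (fun g => (π g * K).trace.re * f' g) (haarProbability G) :=
      YM2.integrable_of_continuous ((continuous_re_trace_mul π hπ K).mul f'.continuous)
    simp only [ContinuousMap.add_apply, mul_add]
    rw [integral_add hi hi', hf, hf', add_zero]
  · intro r f _ hf
    simp only [ContinuousMap.smul_apply, smul_eq_mul]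
    simp_rw [mul_left_comm _ r, integral_const_mul, hf, mul_zero]

omit [IsTopologicalGroup G] [CompactSpace G] [MeasurableSpace G] [BorelSpace G] in
/-- Step 2: the subalgebra generated by the `gen M` separates points (`ρ` faithful). -/
theorem separatesPoints_adjoin (hρi : Function.Injective ρ)
    (gen : Matrix (Fin N) (Fin N) ℂ → C(G, ℝ)) (hgen : ∀ M g, gen M g = (ρ g * M).trace.re) :
    (Algebra.adjoin ℝ (Set.range gen)).SeparatesPoints := by
  intro g h hgh
  have hne : ρ g ≠ ρ h := fun he => hgh (hρi he)
  obtain ⟨c, d, hcd⟩ : ∃ c d, ρ g c d ≠ ρ h c d := by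
    by_contra hall
    push Not at hall
    exact hne (Matrix.ext fun c d => hall c d)
  by_cases hre : (ρ g c d).re ≠ (ρ h c d).re
  · refine ⟨gen (Matrix.single d c 1), ⟨gen (Matrix.single d c 1), Algebra.subset_adjoin ⟨_, rfl⟩, rfl⟩, ?_⟩
    rw [hgen, hgen, re_trace_mul_single, re_trace_mul_single, mul_one, mul_one]
    exact hre
  · push Not at hre
    have him : (ρ g c d).im ≠ (ρ h c d).im := fun him => hcd (Complex.ext hre him)
    refine ⟨gen (Matrix.single d c (-Complex.I)),
      ⟨gen (Matrix.single d c (-Complex.I)), Algebra.subset_adjoin ⟨_, rfl⟩, rfl⟩, ?_⟩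
    rw [hgen, hgen, re_trace_mul_single, re_trace_mul_single]
    simpa only [mul_neg, Complex.neg_re, Complex.mul_I_re, neg_neg, ne_eq] using him

/-- Step 3: a functional `f ↦ ∫ w f` with bounded continuous weight that kills a dense set of `C(G, ℝ)` kills everything. -/
theorem integral_mul_eq_zero_of_dense {w : G → ℝ} (hw : Continuous w) {A : Subalgebra ℝ C(G, ℝ)}
    (hA : A.SeparatesPoints) (hA0 : ∀ f ∈ A, ∫ g, w g * f g ∂haarProbability G = 0) (f : C(G, ℝ)) :
    ∫ g, w g * f g ∂haarProbability G = 0 := by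
  obtain ⟨C, hC⟩ : ∃ C : ℝ, ∀ g : G, |w g| ≤ C := by
    obtain ⟨C, hC⟩ := isCompact_univ.exists_bound_of_continuousOn hw.continuousOn
    exact ⟨C, fun g => Real.norm_eq_abs _ ▸ hC g (Set.mem_univ g)⟩
  have hC0 : 0 ≤ C := le_trans (abs_nonneg _) (hC 1)
  have hint : ∀ q : C(G, ℝ), Integrable (fun g => w g * q g) (haarProbability G) := fun q =>
    YM2.integrable_of_continuous (hw.mul q.continuous)
  by_contra hne
  have hIpos : 0 < |∫ g, w g * f g ∂haarProbability G| := abs_pos.2 hne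
  obtain ⟨p, hp⟩ := ContinuousMap.exists_mem_subalgebra_near_continuousMap_of_separatesPoints A hA f
    (|∫ g, w g * f g ∂haarProbability G| / (C + 1)) (by positivity)
  have hp0 : ∫ g, w g * (p : C(G, ℝ)) g ∂haarProbability G = 0 := hA0 _ p.2
  have hdiff : ∫ g, w g * f g ∂haarProbability G = ∫ g, w g * (f g - (p : C(G, ℝ)) g) ∂haarProbability G := by
    simp only [mul_sub]
    rw [integral_sub (hint f) (hint p), hp0, sub_zero]
  have hle : ∀ g, |w g * (f g - (p : C(G, ℝ)) g)| ≤ C * (|∫ g, w g * f g ∂haarProbability G| / (C + 1)) := by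
    intro g
    rw [abs_mul]
    refine mul_le_mul (hC g) ?_ (abs_nonneg _) hC0
    have h1 : |((p : C(G, ℝ)) - f) g| ≤ ‖(p : C(G, ℝ)) - f‖ := by
      rw [← Real.norm_eq_abs]; exact ContinuousMap.norm_coe_le_norm _ g
    rw [ContinuousMap.sub_apply, abs_sub_comm] at h1
    exact h1.trans hp.le
  have hbound : |∫ g, w g * f g ∂haarProbability G| ≤ C * (|∫ g, w g * f g ∂haarProbability G| / (C + 1)) := by
    have hi : Integrable (fun g => w g * (f g - (p : C(G, ℝ)) g)) (haarProbability G) :=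
      YM2.integrable_of_continuous (hw.mul (f.continuous.sub (p : C(G, ℝ)).continuous))
    calc |∫ g, w g * f g ∂haarProbability G| = |∫ g, w g * (f g - (p : C(G, ℝ)) g) ∂haarProbability G| := by
          rw [← hdiff]
      _ ≤ ∫ g, |w g * (f g - (p : C(G, ℝ)) g)| ∂haarProbability G := abs_integral_le_integral_abs
      _ ≤ ∫ _g, C * (|∫ g, w g * f g ∂haarProbability G| / (C + 1)) ∂haarProbability G :=
          integral_mono hi.abs (integrable_const _) hle
      _ = C * (|∫ g, w g * f g ∂haarProbability G| / (C + 1)) := by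
          rw [integral_const, probReal_univ, one_smul]
  have hlt : C * (|∫ g, w g * f g ∂haarProbability G| / (C + 1)) < |∫ g, w g * f g ∂haarProbability G| := by
    have hq : C / (C + 1) < 1 := by rw [div_lt_one (by positivity)]; linarith
    calc C * (|∫ g, w g * f g ∂haarProbability G| / (C + 1))
        = |∫ g, w g * f g ∂haarProbability G| * (C / (C + 1)) := by ring
      _ < |∫ g, w g * f g ∂haarProbability G| * 1 := mul_lt_mul_of_pos_left hq hIpos
      _ = |∫ g, w g * f g ∂haarProbability G| := mul_one _
  exact absurd (lt_of_le_of_lt hbound hlt) (lt_irrefl _)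

/-- **Some single-link integral does not vanish** (`ρ` faithful, `π` of positive size). -/
theorem exists_integral_ne_zero [T2Space G] (hπ : Continuous π) (hρ : Continuous ρ) (hρi : Function.Injective ρ)
    (hm : 0 < m) :
    ∃ (n : ℕ) (K : Matrix (Fin m) (Fin m) ℂ) (M : Fin n → Matrix (Fin N) (Fin N) ℂ),
      ∫ g, (π g * K).trace.re * ∏ i, (ρ g * M i).trace.re ∂haarProbability G ≠ 0 := by
  by_contra hcon
  push Not at hcon
  obtain ⟨gen, hgen⟩ : ∃ gen : Matrix (Fin N) (Fin N) ℂ → C(G, ℝ), ∀ M g, gen M g = (ρ g * M).trace.re :=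
    ⟨fun M => ⟨fun g => (ρ g * M).trace.re, continuous_re_trace_mul ρ hρ M⟩, fun M g => rfl⟩
  -- the functional with weight `Re tr π` kills every continuous function
  have hall : ∀ f : C(G, ℝ), ∫ g, (π g * 1).trace.re * f g ∂haarProbability G = 0 :=
    integral_mul_eq_zero_of_dense (continuous_re_trace_mul π hπ 1) (separatesPoints_adjoin ρ hρi gen hgen)
      (fun f hf => integral_mul_eq_zero_of_mem_adjoin π ρ hπ gen hgen hcon hf 1)
  -- in particular `∫ (Re tr π)² = 0`, absurd since `Re tr π(1) = m > 0`
  have hsq := hall ⟨fun g => (π g * 1).trace.re, continuous_re_trace_mul π hπ 1⟩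
  simp only [ContinuousMap.coe_mk] at hsq
  have hpos : 0 < ∫ g, (π g * 1).trace.re * (π g * 1).trace.re ∂haarProbability G := by
    refine Continuous.integral_pos_of_hasCompactSupport_nonneg_nonzero (x := (1 : G))
      ((continuous_re_trace_mul π hπ 1).mul (continuous_re_trace_mul π hπ 1))
      (HasCompactSupport.of_compactSpace _) (fun g => mul_self_nonneg _) ?_
    intro h1
    simp only [map_one, Matrix.one_mul, Matrix.trace_one, Fintype.card_fin, Complex.natCast_re,
      mul_self_eq_zero, Nat.cast_eq_zero] at h1
    omega
  exact hpos.ne' hsq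

end Existence

/-! ## §3 The order and the floor coefficient -/

/-- **The order of the `π`-plaquette.**  For faithful continuous unitary `ρ` and continuous `π` of positive size there is
`k : ℕ` such that (i) every single-link integral with fewer than `k` `ρ`-factors vanishes and (ii) the floor coefficient at
order `k` is positive: `∫ Re tr π(g) · (Re tr ρ(g))^k dg ≥ 2^{-k}`. -/
theorem exists_order [T2Space G] (π : G →* Matrix (Fin m) (Fin m) ℂ) (ρ : G →* Matrix (Fin N) (Fin N) ℂ)
    (hπ : Continuous π) (hρ : Continuous ρ) (hρi : Function.Injective ρ) (hm : 0 < m) :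
    ∃ k : ℕ,
      (∀ n < k, ∀ (K : Matrix (Fin m) (Fin m) ℂ) (M : Fin n → Matrix (Fin N) (Fin N) ℂ),
        ∫ g, (π g * K).trace.re * ∏ i, (ρ g * M i).trace.re ∂haarProbability G = 0) ∧
      (2⁻¹ : ℝ) ^ k ≤ ∫ g, (π g).trace.re * ((ρ g).trace.re) ^ k ∂haarProbability G := by
  classical
  obtain ⟨n₀, K₀, M₀, h₀⟩ := exists_integral_ne_zero π ρ hπ hρ hρi hm
  let P : ℕ → Prop := fun n => ∃ (K : Matrix (Fin m) (Fin m) ℂ) (M : Fin n → Matrix (Fin N) (Fin N) ℂ),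
    ∫ g, (π g * K).trace.re * ∏ i, (ρ g * M i).trace.re ∂haarProbability G ≠ 0
  have hP : ∃ n, P n := ⟨n₀, K₀, M₀, h₀⟩
  refine ⟨Nat.find hP, fun n hn K M => ?_, ?_⟩
  · by_contra h
    exact Nat.find_min hP hn ⟨K, M, h⟩
  · obtain ⟨K, M, hKM⟩ := Nat.find_spec hP
    have ht : ∃ t : Fin (Nat.find hP) → Bool, haarAvg (sigma π ρ t) ≠ 0 := by
      by_contra hall
      push Not at hall
      exact hKM (integral_re_trace_mul_prod_eq_zero π ρ hπ hρ hall K M)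
    simpa only [Fintype.card_fin] using integral_re_trace_mul_pow_pos π ρ hπ hρ ht

end Summit.QuantumFields.YangMills.Cruxes.IR.TensionRatio.PlaquetteFloor

end
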